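import Mathlib
import Literature.Barriers.ValiantsHypothesis.AlgebraicNaturalProofs

/-!
# Route BarrierLever — item `PartitionMinorsHitByVP` (stmt-ValiantsHypothesis-19717):
# the TWO-DEEP-SLOTS OBSTRUCTION at every level `m` (kernel form of the seat's (O2) / tensor-level zones)

Helper file (`--supports stmt-ValiantsHypothesis-19717`; cell valiant-natproofs, rung V4, 𝒟-side door (c), line
`hidden_states`; prover seat val-np-p3 gen 12). Definition-free. Closes NO item. A NO-GO lemma for simplex-product designs,
generalising `…SimplexJoinTwoWide` (p623368, the case `m = 1`, `A = univ`) to every level `m` and to every coordinate set `A`.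

MECHANISM. In the exact-support door (`…SimplexJoinDoor`) fix a piece `p` and two factor slots `f₁ ≠ f₂`. The option points of a
slot (together with the empty option `none ↦ 0`) are `|S p f| + 1` points of `ℂ^h`; as soon as there are MORE of them than
multilinear monomials `x^W`, `W ⊆ A`, `|W| ≤ m` (that is, `Σ_{i ≤ m} C(|A|, i) ≤ |S p f|`), they satisfy a nontrivial
MOMENT RELATION of level `m`: weights `Λ`, not all zero, with `Σ_o Λ_o x_o^W = 0` for every such `W`
(`momentRelation_of_card_lt`). The tensor `Λ ⊗ Μ` of two such relations (one per slot) is a column relation on every row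
`U ⊆ A` of size `≤ 2m + 1`: in the expansion of `∏_{a∈U}(c_a + x_a + y_a)` over `W ⊆ U` one of `W`, `U ∖ W` has size `≤ m`
(`sum_sum_prod_eq_zero_level`). Hence (**`det_eq_zero_of_two_deep_slots`**): for EVERY row family `u` with all members inside
`A` and of size `≤ 2m+1`, and EVERY table, the `u`-side matrix of the whole design is SINGULAR — whatever the other pieces are.

WHY IT MATTERS (memo val-np-p3 g12 §4). With `m = 2` and `A = univ`: two slots of `≥ 1 + h + C(h,2)` options kill all rows of
size `≤ 5`. The widest factor the door allows (`(2h)²` options) is such a slot for every `h ≥ 1`, so the square `V_{(2h)²+1}²`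
(and every design containing a piece with two widest slots) is NOT good for the ball `B₅([h])`-families once
`((2h)²+1)² ≤ C(h,≤5)` (`h ≥ 1919`); the tensor-level count (which this lemma realises at the level of kernel vectors) shows the
rank defect already from `h ≈ 500`. So for each FIXED depth `k` the widest power `V_{(2h)²+1}^k` leaves the uniform menu for
large `h`: all-`h` menus under the door's budget must use DEEP pieces at every scale (seat memo §4; this corrects the reading of
memo val-np-p3 g11 §11(d)). Nothing here bears on crux 14610 or on VP ≠ VNP; item 19717 stays OPEN.
-/

set_option linter.dupNamespace false

namespace Summit.ValiantsHypothesis.ValiantsHypothesis.Theorems.BarrierLever.SimplexJoin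

open Finset Matrix

/-- The small subsets of `A`: `{W ⊆ A : |W| ≤ m}` as a finset. -/
theorem mem_filter_powerset_card_le {h : ℕ} (A : Finset (Fin h)) (m : ℕ) (W : Finset (Fin h)) :
    W ∈ A.powerset.filter (fun W => W.card ≤ m) ↔ W ⊆ A ∧ W.card ≤ m := by
  simp [Finset.mem_filter, Finset.mem_powerset]

/-- `#{W ⊆ A : |W| ≤ m} = Σ_{i ≤ m} C(|A|, i)`. -/
theorem card_filter_powerset_card_le {h : ℕ} (A : Finset (Fin h)) (m : ℕ) :
    (A.powerset.filter (fun W => W.card ≤ m)).card = ∑ i ∈ Finset.range (m + 1), A.card.choose i := by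
  classical
  have hdec : A.powerset.filter (fun W => W.card ≤ m) =
      (Finset.range (m + 1)).biUnion (fun i => A.powersetCard i) := by
    ext W
    simp only [Finset.mem_filter, Finset.mem_powerset, Finset.mem_biUnion, Finset.mem_range,
      Finset.mem_powersetCard]
    constructor
    · rintro ⟨hW, hc⟩; exact ⟨W.card, Nat.lt_succ_of_le hc, hW, rfl⟩
    · rintro ⟨i, hi, hW, hci⟩; exact ⟨hW, by omega⟩
  rw [hdec, Finset.card_biUnion]
  · exact Finset.sum_congr rfl fun i _ => Finset.card_powersetCard i A
  · intro i _ j _ hij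
    exact Finset.disjoint_left.mpr fun W hi hj =>
      hij ((Finset.mem_powersetCard.mp hi).2.symm.trans (Finset.mem_powersetCard.mp hj).2)

/-- **Moment relations of level `m`.** If a finset `L` indexes MORE points of `ℂ^h` than there are multilinear monomials
`x^W` with `W ⊆ A`, `|W| ≤ m`, then some weights `Λ`, not all zero, satisfy `Σ_{o∈L} Λ_o ∏_{a∈W} x_o a = 0` for every such `W`.
(`m = 1`, `A = univ`: affine dependence of more than `h + 1` points, `…SimplexJoinTwoWide.affineRelation_of_card`.) -/
theorem momentRelation_of_card_lt (h m : ℕ) (A : Finset (Fin h)) {α : Type*} [DecidableEq α] (L : Finset α)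
    (x : α → Fin h → ℂ) (hcard : (A.powerset.filter (fun W => W.card ≤ m)).card < L.card) :
    ∃ Λ : α → ℂ, (∀ W, W ⊆ A → W.card ≤ m → ∑ o ∈ L, Λ o * ∏ a ∈ W, x o a = 0) ∧ ∃ o ∈ L, Λ o ≠ 0 := by
  classical
  set Sm := A.powerset.filter (fun W => W.card ≤ m) with hSm
  have hli : ¬ LinearIndependent ℂ (fun o : L => (fun W : Sm => ∏ a ∈ (W : Finset (Fin h)), x o a)) := by
    intro hli
    have hle := hli.fintype_card_le_finrank
    rw [Module.finrank_fintype_fun_eq_card, Fintype.card_coe, Fintype.card_coe] at hle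
    omega
  obtain ⟨g, hg, o₀, ho₀⟩ := Fintype.not_linearIndependent_iff.mp hli
  refine ⟨fun o => if ho : o ∈ L then g ⟨o, ho⟩ else 0, ?_, ⟨o₀, o₀.2, by simpa using ho₀⟩⟩
  intro W hWA hWm
  have hW : W ∈ Sm := (mem_filter_powerset_card_le A m W).mpr ⟨hWA, hWm⟩
  have h1 := congrFun hg ⟨W, hW⟩
  simp only [Finset.sum_apply, Pi.smul_apply, smul_eq_mul, Pi.zero_apply] at h1
  rw [← Finset.sum_coe_sort L]
  simpa using h1

/-- One slot: a level-`m` moment relation kills every product of at most `m` affine-linear factors on coordinates of `A`. -/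
theorem sum_mul_prod_eq_zero_of_card_le_level {h m : ℕ} (A : Finset (Fin h)) {α : Type*} (L : Finset α) (Λ : α → ℂ)
    (x : α → Fin h → ℂ) (hrel : ∀ W, W ⊆ A → W.card ≤ m → ∑ o ∈ L, Λ o * ∏ a ∈ W, x o a = 0)
    (c : Fin h → ℂ) (V : Finset (Fin h)) (hVA : V ⊆ A) (hV : V.card ≤ m) :
    ∑ o ∈ L, Λ o * ∏ a ∈ V, (c a + x o a) = 0 := by
  -- expand `∏_{a∈V} (x + c) = Σ_{W ⊆ V} (∏_W x) (∏_{V∖W} c)`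
  have hexp : ∀ o, ∏ a ∈ V, (c a + x o a) = ∑ W ∈ V.powerset, (∏ a ∈ W, x o a) * ∏ a ∈ V \ W, c a := by
    intro o
    rw [← Finset.prod_add]
    exact Finset.prod_congr rfl fun a _ => by ring
  simp_rw [hexp, Finset.mul_sum]
  rw [Finset.sum_comm]
  refine Finset.sum_eq_zero fun W hW => ?_
  have hWV : W ⊆ V := Finset.mem_powerset.mp hW
  calc ∑ o ∈ L, Λ o * ((∏ a ∈ W, x o a) * ∏ a ∈ V \ W, c a)
      = (∑ o ∈ L, Λ o * ∏ a ∈ W, x o a) * ∏ a ∈ V \ W, c a := by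
        rw [Finset.sum_mul]
        exact Finset.sum_congr rfl fun o _ => by ring
    _ = 0 := by
        rw [hrel W (hWV.trans hVA) ((Finset.card_le_card hWV).trans hV), zero_mul]

/-- **The tensor of two level-`m` moment relations kills every row of size `≤ 2m + 1` inside `A`.** -/
theorem sum_sum_prod_eq_zero_level {h m : ℕ} (A : Finset (Fin h)) {α β : Type*} (L₁ : Finset α) (L₂ : Finset β)
    (Λ : α → ℂ) (Μ : β → ℂ) (x : α → Fin h → ℂ) (y : β → Fin h → ℂ) (c : Fin h → ℂ)
    (hl : ∀ W, W ⊆ A → W.card ≤ m → ∑ o ∈ L₁, Λ o * ∏ a ∈ W, x o a = 0)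
    (hm : ∀ W, W ⊆ A → W.card ≤ m → ∑ o ∈ L₂, Μ o * ∏ a ∈ W, y o a = 0)
    (U : Finset (Fin h)) (hUA : U ⊆ A) (hU : U.card ≤ 2 * m + 1) :
    ∑ o ∈ L₁, ∑ o' ∈ L₂, Λ o * Μ o' * ∏ a ∈ U, (c a + x o a + y o' a) = 0 := by
  -- expand in `y`: `∏ (y + (c + x)) = Σ_W (∏_W y) (∏_{U \ W} (c + x))`
  have hexp : ∀ o o', ∏ a ∈ U, (c a + x o a + y o' a) =
      ∑ W ∈ U.powerset, (∏ a ∈ W, y o' a) * ∏ a ∈ U \ W, (c a + x o a) := by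
    intro o o'
    rw [← Finset.prod_add]
    exact Finset.prod_congr rfl fun a _ => by ring
  have hinner : ∀ o, ∑ o' ∈ L₂, Μ o' * ∏ a ∈ U, (c a + x o a + y o' a) =
      ∑ W ∈ U.powerset, (∑ o' ∈ L₂, Μ o' * ∏ a ∈ W, y o' a) * ∏ a ∈ U \ W, (c a + x o a) := by
    intro o
    simp_rw [hexp, Finset.mul_sum]
    rw [Finset.sum_comm]
    refine Finset.sum_congr rfl fun W _ => ?_
    rw [Finset.sum_mul]
    exact Finset.sum_congr rfl fun o' _ => by ring
  calc ∑ o ∈ L₁, ∑ o' ∈ L₂, Λ o * Μ o' * ∏ a ∈ U, (c a + x o a + y o' a)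
      = ∑ o ∈ L₁, Λ o * ∑ o' ∈ L₂, Μ o' * ∏ a ∈ U, (c a + x o a + y o' a) := by
        refine Finset.sum_congr rfl fun o _ => ?_
        rw [Finset.mul_sum]
        exact Finset.sum_congr rfl fun o' _ => by ring
    _ = ∑ o ∈ L₁, Λ o * ∑ W ∈ U.powerset,
          (∑ o' ∈ L₂, Μ o' * ∏ a ∈ W, y o' a) * ∏ a ∈ U \ W, (c a + x o a) := by simp_rw [hinner]
    _ = ∑ W ∈ U.powerset, (∑ o' ∈ L₂, Μ o' * ∏ a ∈ W, y o' a) *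
          ∑ o ∈ L₁, Λ o * ∏ a ∈ U \ W, (c a + x o a) := by
        simp_rw [Finset.mul_sum]
        rw [Finset.sum_comm]
        refine Finset.sum_congr rfl fun W _ => Finset.sum_congr rfl fun o _ => by ring
    _ = 0 := by
        refine Finset.sum_eq_zero fun W hW => ?_
        have hWU : W ⊆ U := Finset.mem_powerset.mp hW
        by_cases hWc : W.card ≤ m
        · have hy0 : ∑ o' ∈ L₂, Μ o' * ∏ a ∈ W, y o' a = 0 := hm W (hWU.trans hUA) hWc
          rw [hy0, zero_mul]
        · have hrest : (U \ W).card ≤ m := by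
            have := Finset.card_sdiff_add_card_eq_card hWU
            omega
          rw [sum_mul_prod_eq_zero_of_card_le_level A L₁ Λ x hl c (U \ W) (Finset.sdiff_subset.trans hUA) hrest,
            mul_zero]

/-- **THE TWO-DEEP-SLOTS OBSTRUCTION (level `m`, coordinate set `A`).** In the exact-support door, let the design `e`
(injective, exactly the live columns of `S`) have a piece `p` and factor slots `f₁ ≠ f₂`, each offering at least
`Σ_{i ≤ m} C(|A|, i)` options. Then for EVERY row family `u : Fin r → Finset (Fin h)` all of whose members lie inside `A`
and have size `≤ 2m + 1`, and EVERY table `T`, the `u`-side matrix of the design is singular. (`m = 1`, `A = univ` is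
`det_eq_zero_of_two_wide_slots`.) -/
theorem det_eq_zero_of_two_deep_slots (h mm M D N r : ℕ) (A : Finset (Fin h)) (u : Fin r → Finset (Fin h))
    (huA : ∀ i, u i ⊆ A) (hum : ∀ i, (u i).card ≤ 2 * mm + 1)
    (S : Fin M → Fin D → Finset (Fin N))
    (e : Fin r → Fin M × (Fin D → Option (Fin N))) (he : Function.Injective e)
    (hlive : ∀ c : Fin M × (Fin D → Option (Fin N)),
      c ∈ Set.range e ↔ ∀ (f : Fin D) (j : Fin N), c.2 f = some j → j ∈ S c.1 f)
    (p : Fin M) (f₁ f₂ : Fin D) (hf : f₁ ≠ f₂)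
    (hS₁ : ∑ i ∈ Finset.range (mm + 1), A.card.choose i ≤ (S p f₁).card)
    (hS₂ : ∑ i ∈ Finset.range (mm + 1), A.card.choose i ≤ (S p f₂).card)
    (T : Fin M → Option (Fin D × Fin N) → Fin h → ℂ) :
    (Matrix.of fun i k : Fin r => ∏ a ∈ u i,
      (T (e k).1 none a + ∑ f : Fin D, ((e k).2 f).elim 0 fun j => T (e k).1 (some (f, j)) a)).det = 0 := by
  classical
  -- the two option families and their moment relations
  set L₁ : Finset (Option (Fin N)) := Finset.insertNone (S p f₁) with hL₁
  set L₂ : Finset (Option (Fin N)) := Finset.insertNone (S p f₂) with hL₂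
  let x : Option (Fin N) → Fin h → ℂ := fun o a => o.elim 0 fun j => T p (some (f₁, j)) a
  let y : Option (Fin N) → Fin h → ℂ := fun o a => o.elim 0 fun j => T p (some (f₂, j)) a
  have hSm := card_filter_powerset_card_le A mm
  have hc₁ : (A.powerset.filter (fun W => W.card ≤ mm)).card < L₁.card := by
    rw [hSm, hL₁, Finset.card_insertNone]; omega
  have hc₂ : (A.powerset.filter (fun W => W.card ≤ mm)).card < L₂.card := by
    rw [hSm, hL₂, Finset.card_insertNone]; omega
  obtain ⟨Λ, hl, o₁, ho₁, hΛ⟩ := momentRelation_of_card_lt h mm A L₁ x hc₁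
  obtain ⟨Μ, hm, o₂, ho₂, hΜ⟩ := momentRelation_of_card_lt h mm A L₂ y hc₂
  -- the sub-grid: patterns `g o o'` (slot f₁ ↦ o, slot f₂ ↦ o', other slots none)
  let pat : Option (Fin N) → Option (Fin N) → (Fin D → Option (Fin N)) :=
    fun o o' f => if f = f₁ then o else if f = f₂ then o' else none
  have hpat₁ : ∀ o o', pat o o' f₁ = o := fun o o' => by simp [pat]
  have hpat₂ : ∀ o o', pat o o' f₂ = o' := fun o o' => by simp [pat, hf.symm]
  have hpat₃ : ∀ o o' f, f ≠ f₁ → f ≠ f₂ → pat o o' f = none := fun o o' f h1 h2 => by simp [pat, h1, h2]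
  have hlivepat : ∀ o ∈ L₁, ∀ o' ∈ L₂, (p, pat o o') ∈ Set.range e := by
    intro o ho o' ho'
    rw [hlive]
    intro f j hfj
    change pat o o' f = some j at hfj
    change j ∈ S p f
    by_cases h1 : f = f₁
    · rw [h1, hpat₁] at hfj
      rw [h1]
      exact Finset.mem_insertNone.mp ho j (by rw [hfj]; rfl)
    · by_cases h2 : f = f₂
      · rw [h2, hpat₂] at hfj
        rw [h2]
        exact Finset.mem_insertNone.mp ho' j (by rw [hfj]; rfl)
      · rw [hpat₃ o o' f h1 h2] at hfj; exact absurd hfj (by simp)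
  -- membership of a column in the sub-grid
  let InGrid : Fin r → Prop := fun k => (e k).1 = p ∧ ∀ f, f ≠ f₁ → f ≠ f₂ → (e k).2 f = none
  have hgrid₁ : ∀ k, InGrid k → (e k).2 f₁ ∈ L₁ := by
    intro k hk
    rw [hL₁, Finset.mem_insertNone]
    intro j hj
    have := ((hlive (e k)).mp ⟨k, rfl⟩) f₁ j hj
    rw [hk.1] at this; exact this
  have hgrid₂ : ∀ k, InGrid k → (e k).2 f₂ ∈ L₂ := by
    intro k hk
    rw [hL₂, Finset.mem_insertNone]
    intro j hj
    have := ((hlive (e k)).mp ⟨k, rfl⟩) f₂ j hj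
    rw [hk.1] at this; exact this
  have hgridpat : ∀ k, InGrid k → e k = (p, pat ((e k).2 f₁) ((e k).2 f₂)) := by
    intro k hk
    refine Prod.ext hk.1 (funext fun f => ?_)
    change (e k).2 f = pat ((e k).2 f₁) ((e k).2 f₂) f
    by_cases h1 : f = f₁
    · rw [h1, hpat₁]
    · by_cases h2 : f = f₂
      · rw [h2, hpat₂]
      · rw [hpat₃ _ _ f h1 h2]; exact hk.2 f h1 h2
  -- the kernel vector
  let v : Fin r → ℂ := fun k => if InGrid k then Λ ((e k).2 f₁) * Μ ((e k).2 f₂) else 0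
  -- the column of the pattern `(o, o')`
  have hkOf : ∀ oo : Option (Fin N) × Option (Fin N), oo ∈ L₁ ×ˢ L₂ → ∃ k, e k = (p, pat oo.1 oo.2) := by
    intro oo hoo
    obtain ⟨ho, ho'⟩ := Finset.mem_product.mp hoo
    obtain ⟨k, hk⟩ := hlivepat oo.1 ho oo.2 ho'
    exact ⟨k, hk⟩
  let kOf : Option (Fin N) × Option (Fin N) → Fin r := fun oo =>
    if hoo : oo ∈ L₁ ×ˢ L₂ then (hkOf oo hoo).choose else ⟨0, by
      have : 0 < r := Fin.pos (hkOf (o₁, o₂) (Finset.mem_product.mpr ⟨ho₁, ho₂⟩)).choose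
      exact this⟩
  have hkOf_spec : ∀ oo ∈ L₁ ×ˢ L₂, e (kOf oo) = (p, pat oo.1 oo.2) := by
    intro oo hoo
    simp only [kOf, dif_pos hoo]
    exact (hkOf oo hoo).choose_spec
  have hkOf_grid : ∀ oo ∈ L₁ ×ˢ L₂, InGrid (kOf oo) := by
    intro oo hoo
    refine ⟨by rw [hkOf_spec oo hoo], fun f h1 h2 => ?_⟩
    rw [hkOf_spec oo hoo]
    exact hpat₃ _ _ f h1 h2
  have hv : v ≠ 0 := by
    intro hv
    have hoo : (o₁, o₂) ∈ L₁ ×ˢ L₂ := Finset.mem_product.mpr ⟨ho₁, ho₂⟩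
    have h0 := congrFun hv (kOf (o₁, o₂))
    have h1 : v (kOf (o₁, o₂)) = Λ ((e (kOf (o₁, o₂))).2 f₁) * Μ ((e (kOf (o₁, o₂))).2 f₂) := if_pos (hkOf_grid _ hoo)
    rw [h1, hkOf_spec _ hoo, Pi.zero_apply] at h0
    change Λ (pat o₁ o₂ f₁) * Μ (pat o₁ o₂ f₂) = 0 at h0
    rw [hpat₁, hpat₂] at h0
    exact (mul_eq_zero.mp h0).elim hΛ hΜ
  -- the point of a sub-grid column
  have hpoint : ∀ k, InGrid k → ∀ a, T (e k).1 none a + ∑ f : Fin D, ((e k).2 f).elim 0 (fun j => T (e k).1 (some (f, j)) a) =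
      T p none a + x ((e k).2 f₁) a + y ((e k).2 f₂) a := by
    intro k hk a
    rw [hk.1, Fintype.sum_eq_add f₁ f₂ hf]
    · simp only [x, y, add_assoc]
    · intro f hff
      rw [hk.2 f hff.1 hff.2]; rfl
  -- `M v = 0`
  apply (Matrix.exists_mulVec_eq_zero_iff).mp
  refine ⟨v, hv, funext fun i => ?_⟩
  simp only [Matrix.mulVec, dotProduct, Matrix.of_apply, Pi.zero_apply]
  calc ∑ k, (∏ a ∈ u i, (T (e k).1 none a + ∑ f : Fin D, ((e k).2 f).elim 0 fun j => T (e k).1 (some (f, j)) a)) * v k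
      = ∑ k ∈ Finset.univ.filter InGrid, Λ ((e k).2 f₁) * Μ ((e k).2 f₂) *
          ∏ a ∈ u i, (T p none a + x ((e k).2 f₁) a + y ((e k).2 f₂) a) := by
        rw [Finset.sum_filter]
        refine Finset.sum_congr rfl fun k _ => ?_
        by_cases hk : InGrid k
        · have hv' : v k = Λ ((e k).2 f₁) * Μ ((e k).2 f₂) := if_pos hk
          rw [if_pos hk, hv', Finset.prod_congr rfl fun a _ => hpoint k hk a]
          ring
        · have hv' : v k = 0 := if_neg hk
          rw [if_neg hk, hv', mul_zero]
    _ = ∑ oo ∈ L₁ ×ˢ L₂, Λ oo.1 * Μ oo.2 * ∏ a ∈ u i, (T p none a + x oo.1 a + y oo.2 a) := by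
        refine Finset.sum_nbij' (fun k => ((e k).2 f₁, (e k).2 f₂)) kOf ?_ ?_ ?_ ?_ ?_
        · intro k hk
          have hk' := (Finset.mem_filter.mp hk).2
          exact Finset.mem_product.mpr ⟨hgrid₁ k hk', hgrid₂ k hk'⟩
        · intro oo hoo
          exact Finset.mem_filter.mpr ⟨Finset.mem_univ _, hkOf_grid oo hoo⟩
        · intro k hk
          have hk' := (Finset.mem_filter.mp hk).2
          have hoo : ((e k).2 f₁, (e k).2 f₂) ∈ L₁ ×ˢ L₂ := Finset.mem_product.mpr ⟨hgrid₁ k hk', hgrid₂ k hk'⟩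
          apply he
          rw [hkOf_spec _ hoo, ← hgridpat k hk']
        · intro oo hoo
          refine Prod.ext ?_ ?_
          · show (e (kOf oo)).2 f₁ = oo.1
            rw [hkOf_spec oo hoo]; exact hpat₁ _ _
          · show (e (kOf oo)).2 f₂ = oo.2
            rw [hkOf_spec oo hoo]; exact hpat₂ _ _
        · intro k _; rfl
    _ = ∑ o ∈ L₁, ∑ o' ∈ L₂, Λ o * Μ o' * ∏ a ∈ u i, (T p none a + x o a + y o' a) := Finset.sum_product _ _ _
    _ = 0 := sum_sum_prod_eq_zero_level A L₁ L₂ Λ Μ x y (fun a => T p none a) hl hm (u i) (huA i) (hum i)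

/-- **Corollary (`A = univ`, level `m`).** Two slots with at least `Σ_{i ≤ m} C(h, i)` options each make the `u`-side matrix
singular for every row family of sets of size `≤ 2m + 1` and every table. (`m = 1`: `…TwoWide`; `m = 2`: two slots of
`≥ 1 + h + C(h,2)` options — in particular two widest slots, `(2h)²` options, `h ≥ 1` — kill all rows of size `≤ 5`.) -/
theorem det_eq_zero_of_two_deep_slots_univ (h mm M D N r : ℕ) (u : Fin r → Finset (Fin h))
    (hum : ∀ i, (u i).card ≤ 2 * mm + 1)
    (S : Fin M → Fin D → Finset (Fin N))
    (e : Fin r → Fin M × (Fin D → Option (Fin N))) (he : Function.Injective e)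
    (hlive : ∀ c : Fin M × (Fin D → Option (Fin N)),
      c ∈ Set.range e ↔ ∀ (f : Fin D) (j : Fin N), c.2 f = some j → j ∈ S c.1 f)
    (p : Fin M) (f₁ f₂ : Fin D) (hf : f₁ ≠ f₂)
    (hS₁ : ∑ i ∈ Finset.range (mm + 1), h.choose i ≤ (S p f₁).card)
    (hS₂ : ∑ i ∈ Finset.range (mm + 1), h.choose i ≤ (S p f₂).card)
    (T : Fin M → Option (Fin D × Fin N) → Fin h → ℂ) :
    (Matrix.of fun i k : Fin r => ∏ a ∈ u i,
      (T (e k).1 none a + ∑ f : Fin D, ((e k).2 f).elim 0 fun j => T (e k).1 (some (f, j)) a)).det = 0 := by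
  have hA : (Finset.univ : Finset (Fin h)).card = h := Finset.card_fin h
  refine det_eq_zero_of_two_deep_slots h mm M D N r Finset.univ u (fun i => Finset.subset_univ _) hum S e he hlive
    p f₁ f₂ hf ?_ ?_ T
  · rwa [hA]
  · rwa [hA]

/-- The widest slot of the door (`(2h)²` options) is deep at level `2`: `1 + h + C(h,2) ≤ (2h)²` for every `h ≥ 1`. -/
theorem level_two_le_widest (h : ℕ) (hh : 1 ≤ h) : ∑ i ∈ Finset.range (2 + 1), h.choose i ≤ (h + h) ^ 2 := by
  simp only [Finset.sum_range_succ, Finset.sum_range_zero, Nat.choose_zero_right, Nat.choose_one_right,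
    zero_add]
  have h2 : h.choose 2 ≤ h * h := by
    rw [Nat.choose_two_right]
    calc h * (h - 1) / 2 ≤ h * (h - 1) := Nat.div_le_self _ _
      _ ≤ h * h := Nat.mul_le_mul_left h (Nat.sub_le h 1)
  have h3 : h ≤ h * h := Nat.le_mul_self h
  nlinarith [h2, h3, hh]

end Summit.ValiantsHypothesis.ValiantsHypothesis.Theorems.BarrierLever.SimplexJoin
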